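import Literature.Probability.Percolation.ArmSeparationFrame
import HarnessLib

/-!
# Protection from above against arms of the SAME colour: open escapes are joined to the crossing

Topic: Probability / Percolation; family `crit-perc` / near-critical percolation on `𝕋`. A
deterministic brick of the arm-separation theorem for FOUR arms of alternating colours (Nolin
2008, Thm. 11 [arXiv 0711.4948: Thm. 10] for `j = 4`, `σ = BWBW`; the hypothesis of
`Werner2009_fourArm_quasiMult_of_separation`, `Nolin2008_cor41_of_separation` and of the
`…_of_altSeparation…` reductions of the tree), complementing `ArmSeparationFrame.lean`.

In Kesten's separation step (Nolin 2008, §4.4, proof of Lemma 15 [arXiv Lemma 14]) the tip `z_u`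
of a lowest crossing `c_u` is "protected from above" by circuits in annuli about `z_u` lying in the
region above `c_u`: "a white circuit … preventing other disjoint black crossings to arrive near
`z_u`, and also a black one …, preventing white crossings to arrive". For two arms of opposite
colours (`j = 2`, `ArmSeparationFrame.lean`) only the second protection is needed, and it comes for
free with the open frame used for the extension (`trap_no_closed_escape`). With two arms of the
SAME colour (the two open arms of `BWBW`) the first protection is needed as well. This file
derives it, again for free, from the SAME open frame, in the form adapted to the cluster form of
the alternating four-arm event (`altFourArm`, `AltFourArm.lean`: the two open arms lie in distinct
open clusters of the annulus):

* `trap_open_escape_joins` — let `c` be a crossing of `trapDomain M` with tip `z`, open in `ω`, and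
  let `ω'` agree with `ω` off `lower c z` and contain the open frame at scale `k` about `z`
  (`1 ≤ k`, `2k + 1 ≤ M`). Then every OPEN `𝕋`-path of the trapezoid in `ω` from a top-type
  boundary site `q` (`Tp ∪ J_{>z}`) inside the inner box of the frame to a site outside its outer
  box is joined to the tip: there is an open path of `ω` from `q` to `z` inside the trapezoid
  together with the fence zone `trapFrameZone M z k`.

  Proof: if the path meets `c`, follow `c` (connected, open) to its tip. Otherwise it runs in
  `T ∖ c` from a top-type site, hence inside `above c z` (`JDomain.mem_above_of_pathIn'`), and it
  meets the frame (`FrameData.exists_mem_K`) at a site `x` of the trapezoid, hence of the union `Y`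
  of the top, bottom and left crossings; from `x` follow `Y` to the first site adjacent to `c`
  (`c` meets `Y`), along which the invariant of `trap_invariant_step` ("inside `Λ_{2M}`: above `c`;
  outside: strictly above the row of the tip") propagates from `x`, so that all these sites are
  unfrozen, open in `ω`, and in the fence zone — verbatim the second half of `trap_exists_fence`.

Consequence used downstream (outer surgery for four arms): if a second open arm, lying in a
different open cluster of the annulus than the arm through `c`, landed at a top-type site within
the inner box of the protecting frame of `z`, its final segment would be such an open escape,
joining the two clusters — so same-colour tips are far apart, exactly as opposite-colour tips are
by `trap_no_closed_escape`. Everything here is proved; no named facts are introduced.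

## References

* P. Nolin, *Near-critical percolation in two dimensions*, Electron. J. Probab. 13 (2008), §4.4,
  proof of Lemma 15 ("protected from above"; arXiv 0711.4948: Lemma 14) and Thm. 11. [Nolin2008]
* H. Kesten, *Scaling relations for 2D-percolation*, Comm. Math. Phys. 109 (1987), Lemma 2. [Kesten1987]
* G. Grimmett, *Percolation*, 2nd ed. (1999), §11.8 (square-annulus frames). [GrimmettPercolation1999]

Tree: `triFrameAt`, `trapFrameZone`, `FrameData` (`nonempty_frameData`, `exists_mem_K`, `pathIn_Y`,
`K_subset`, `Y_subset_K`, `boundsK`, `boundsE`), `trap_invariant_step`, `PathIn.inter_of_invariant`,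
`start_apply_zero_le` (`ArmSeparationFrame.lean`); `trapDomain`, `trapD`, `trapO_coord`,
`mem_trapD`, `mem_trapD_iff_triNorm`, `mem_trapD_of_triNorm_le` (`ArmSeparationTrapezoid.lean`);
`JDomain.IsCrossing` API, `mem_above_of_pathIn'`, `mem_lower_iff_not_mem_above`, `lower_subset_D`
(`TriLowestCrossing.lean`); `PathIn.exists_support`, `PathIn.exit`, `PathIn.of_adj`.
-/

noncomputable section

open Set

namespace Literature.Probability.Percolation

open LatticeModels

variable {M k : ℕ} {c : Finset (Site 2)} {z : Site 2}

/-- **Open escapes from above are joined to the crossing.** Let `c` be a crossing of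
`trapDomain M` with tip `z`, open in `ω`; let `ω'` agree with `ω` off `lower c z` and contain the
open frame at scale `k` about `z` (`1 ≤ k`, `2k + 1 ≤ M`). Then every open `𝕋`-path of the
trapezoid in `ω` from a top-type boundary site `q ∈ Tp ∪ J_{>z}` inside the inner box of the frame
to a site outside its outer box is joined to the tip `z` by an open path of `ω` inside the
trapezoid together with the fence zone `trapFrameZone M z k` (Nolin 2008, §4.4, proof of Lemma 15:
the circuits above the lowest crossing "preventing other disjoint black crossings to arrive near
`z_u`" — here: any black crossing arriving near `z_u` from above is in the black cluster of `c_u`). [cite: Nolin2008, §4.4 Lemma 15 (proof) (arXiv 0711.4948: Lemma 14)] -/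
theorem trap_open_escape_joins (hk : 1 ≤ k) (hkM : 2 * (k : ℤ) + 1 ≤ M) (hc : (trapDomain M).IsCrossing c z)
    {ω ω' : SiteConfig (Site 2)} (hcω : (↑c : Set (Site 2)) ⊆ ω)
    (hagree : ∀ v, v ∉ (trapDomain M).lower c z → (v ∈ ω' ↔ v ∈ ω)) (hframe : ω' ∈ triFrameAt z k)
    {q t : Site 2} (hq : q ∈ (trapDomain M).Tp ∪ (trapDomain M).Jabove z)
    (hqin : z 0 - k ≤ q 0 ∧ q 0 ≤ z 0 + k ∧ z 1 - k ≤ q 1 ∧ q 1 ≤ z 1 + k)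
    (ht : t 0 ≤ z 0 - 2 * k ∨ z 0 + 2 * k ≤ t 0 ∨ t 1 ≤ z 1 - 2 * k ∨ z 1 + 2 * k ≤ t 1)
    (hpath : PathIn triGraph ((↑(trapD M) : Set (Site 2)) ∩ ω) q t) :
    PathIn triGraph (((↑(trapD M) : Set (Site 2)) ∪ trapFrameZone M z k) ∩ ω) q z := by
  have hk' : (1 : ℤ) ≤ k := by exact_mod_cast hk
  have hzO := tip_mem_trapO hc
  have hz' := trapO_coord hzO
  obtain ⟨F⟩ := nonempty_frameData hframe
  -- the target region
  set A : Set (Site 2) := ((↑(trapD M) : Set (Site 2)) ∪ trapFrameZone M z k) ∩ ω with hA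
  have hDA : (↑(trapD M) : Set (Site 2)) ∩ ω ⊆ A := fun v hv => ⟨Or.inl hv.1, hv.2⟩
  have hZA : trapFrameZone M z k ∩ ω ⊆ A := fun v hv => ⟨Or.inr hv.1, hv.2⟩
  have hcD : (↑c : Set (Site 2)) ⊆ ↑(trapD M) := Finset.coe_subset.2 hc.subset
  have hcA : (↑c : Set (Site 2)) ⊆ A := fun v hv => hDA ⟨hcD hv, hcω hv⟩
  -- a tight support of the escaping path
  obtain ⟨Tq, hTq, hqt, htight⟩ := hpath.exists_support
  have hTqA : Tq ⊆ A := fun v hv => hDA (hTq hv)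
  by_cases hmeet : ∃ v ∈ Tq, v ∈ (↑c : Set (Site 2))
  · -- the path meets `c`: follow `c` to its tip
    obtain ⟨v, hvT, hvc⟩ := hmeet
    exact ((htight v hvT).mono hTqA).trans ((hc.conn v (Finset.mem_coe.1 hvc) z hc.tip_mem).mono hcA)
  -- otherwise it runs in `T ∖ c`, above `c`
  push Not at hmeet
  have hTq' : Tq ⊆ (↑((trapDomain M).D \ c) : Set (Site 2)) := by
    intro v hv
    rw [Finset.coe_sdiff]
    exact ⟨(hTq hv).1, hmeet v hv⟩
  have hqc : q ∉ c := fun h => hmeet q hqt.left_mem (Finset.mem_coe.2 h)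
  have hqabove : q ∈ (trapDomain M).above c z := by
    rcases Finset.mem_union.1 hq with h | h
    · exact hc.mem_above_of_mem_Tp h hqc
    · exact hc.mem_above_of_mem_Jabove h
  -- it meets the frame at a site `x` of the trapezoid, hence of `Y`, above `c`
  obtain ⟨x, hxT, hxK⟩ := F.exists_mem_K hk hqin ht hqt
  have hxD : x ∈ trapD M := Finset.mem_coe.1 (hTq hxT).1
  have hxn : triNorm x ≤ 2 * M := (mem_trapD_iff_triNorm.1 hxD).2
  have hxY : x ∈ F.Y := by
    rcases hxK with hx | hx
    · exact hx
    · exfalso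
      have h1 := (F.boundsE hx).1
      have h2 := (mem_trapD.1 hxD).2.1
      omega
  have hxabove : x ∈ (trapDomain M).above c z := JDomain.mem_above_of_pathIn' hqabove ((htight x hxT).mono hTq')
  have hxc : x ∈ (↑c : Set (Site 2))ᶜ := hmeet x hxT
  -- sites off `lower c z` (in particular sites outside `Λ_{2M}`) carry the same colour in `ω`, `ω'`
  have hlowD : ∀ v ∈ (trapDomain M).lower c z, v ∈ trapD M := fun v hv => JDomain.lower_subset_D hc.subset hv
  have hext : ∀ v : Site 2, 2 * (M : ℤ) < triNorm v → (v ∈ ω' ↔ v ∈ ω) := by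
    intro v hv
    refine hagree v fun h => ?_
    have := (mem_trapD_iff_triNorm.1 (hlowD v h)).2
    omega
  -- `c` meets `Y`
  obtain ⟨f, hfc, hfI⟩ := hc.exists_start
  obtain ⟨y, hyc, hyK⟩ := F.exists_mem_K hk (s := z) (t := f) (by omega)
    (Or.inl (start_apply_zero_le hc hkM hfI)) (hc.conn z hc.tip_mem f hfc)
  have hyc' : y ∈ c := Finset.mem_coe.1 hyc
  have hyY : y ∈ F.Y := by
    rcases hyK with hy | hy
    · exact hy
    · exfalso
      have h1 := (F.boundsE hy).1
      have h2 := (mem_trapD.1 (hc.subset hyc')).2.1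
      omega
  -- follow `Y` from `x` to the first site adjacent to `c`
  obtain ⟨p, q', hpc, hq'c, hq'Y, hpq', hxp⟩ := (F.pathIn_Y hk hxY hyY).exit (R := (↑c : Set (Site 2))ᶜ) hxc (fun h => h hyc)
  have hq'c' : q' ∈ c := Finset.mem_coe.1 (not_not.1 hq'c)
  have hxp' : PathIn triGraph (F.Y \ ↑c) x p := hxp.mono fun v hv => ⟨hv.2, hv.1⟩
  -- the invariant along this path, started at `x` (inside `Λ_{2M}`, above `c`)
  set G : Set (Site 2) := {v | (triNorm v ≤ 2 * M → v ∈ (trapDomain M).above c z) ∧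
      (2 * (M : ℤ) < triNorm v → z 1 < v 1)} with hG
  have hxG : x ∈ G := ⟨fun _ => hxabove, fun h => absurd hxn (not_le.2 h)⟩
  have hpathY : PathIn triGraph ((F.Y \ ↑c) ∩ G) x p :=
    hxp'.inter_of_invariant hxG fun a b ha haG hb hab => trap_invariant_step hk hkM hc F ha hb hab haG.1 haG.2
  -- sites satisfying the invariant are open sites of the zone
  have hsub : (F.Y \ ↑c) ∩ G ⊆ trapFrameZone M z k ∩ ω := by
    rintro v ⟨⟨hvY, -⟩, hvin, hvout⟩
    have hb := F.boundsK (F.Y_subset_K hvY)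
    have hvω' : v ∈ ω' := F.K_subset (F.Y_subset_K hvY)
    by_cases hvn : triNorm v ≤ 2 * M
    · have hvT : v ∈ trapD M := mem_trapD_of_triNorm_le (by omega) hvn
      refine ⟨⟨Or.inl hvT, by omega, by omega, by omega, by omega⟩, ?_⟩
      have hva := hvin hvn
      have hvl : v ∉ (trapDomain M).lower c z := fun h =>
        ((JDomain.mem_lower_iff_not_mem_above (show v ∈ (trapDomain M).D from hvT)).1 h) hva
      exact (hagree v hvl).1 hvω'
    · rw [not_le] at hvn
      exact ⟨⟨Or.inr ⟨hvn, hvout hvn⟩, by omega, by omega, by omega, by omega⟩, (hext v hvn).1 hvω'⟩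
  -- assemble: `q → x` along the escaping path, `x → p` along `Y`, the edge `p — q'`, and `c` to the tip
  have h1 : PathIn triGraph A q x := (htight x hxT).mono hTqA
  have h2 : PathIn triGraph A x p := (hpathY.mono hsub).mono hZA
  have hpA : p ∈ A := h2.right_mem
  have hq'A : q' ∈ A := hcA (Finset.mem_coe.2 hq'c')
  have h3 : PathIn triGraph A p q' := PathIn.of_adj hpA hq'A hpq'
  have h4 : PathIn triGraph A q' z := (hc.conn q' hq'c' z hc.tip_mem).mono hcA
  exact ((h1.trans h2).trans h3).trans h4

end Literature.Probability.Percolation
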